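import Summits.BirchSwinnertonDyer.BirchSwinnertonDyer.Theorems.SignedLowerHalvesKobayashiLowerHalfLargeImageParityStratumFE
import Summits.BirchSwinnertonDyer.Rank1Residual.X1.LambdaParity
import Summits.BirchSwinnertonDyer.Rank1Residual.Supersingular.SignedLambdaParity
import HarnessLib

/-!
# Route `SignedLowerHalves` (K3), child crux L `SmallImageLowerHalfBothSigns` (item stmt-BirchSwinnertonDyer-23599),
# line `birth_acns`, stub `stub_lambdaLowerThree_ns`: the λ-PARITY of Pollack's `L_p^ε` WITHOUT `μ = 0` —
# `w(E) = (−1)^{λ(L_p^ε)}` for both signs at every odd good supersingular prime with `a_p = 0`, NO named fact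
# (cell `bsd-ssimc`, width seat `bsd-line-slh-p3-w3` gen 3; ROUTE-INDEPENDENT helper, `--supports 23599`)

HONEST FRAMING: CALIBRATION / SUPPORT ONLY. The stub `stub_lambdaLowerThree_ns` (= retired item 23118, the
Eisenstein λ-inequality `λ(L_3^ε) ≤ λ(ξ^ε)` at the small-image `p = 3` X7 pairs) is OPEN MATHEMATICS (w3 g0,
`…LambdaLowerThreeNs.lean`); nothing here closes it, and BSD / child L are NOT proved. THEOREMS ONLY: no
definition, no named fact, no `sorry`. What this file removes is the hypothesis `μ(L_p^ε) = 0` from the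
λ-parity of the signed `p`-adic `L`-functions — at small image and `p = 3` that hypothesis is itself the open
μ-content of the cone (w2 g2: `LS-0(3)`), so the tree's parity theorems
(`Supersingular.even_lam_signed_iff_even_analyticRank`, `hμ : mu L = 0`; `SignedMuVanishing.X7.mu_signed_eq_zero`,
under the conjecture-grade node) said nothing there.

## The mechanism (Greenberg, LNM 1716, §5 p. 181: the root pairing `a ↔ (1+a)⁻¹ − 1`)

Sprung's functional equation of the pair at `a_p = 0` is a THEOREM of the tree
(`Sprung2017.cor414_sharpFlat_functionalEquation_apZero_holds`: `L^•(T^ι) = σ (1+T)^{c+·} L^•(T)` IN `Λ`,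
`σ = −ε_N(f)`, `T^ι = (1+T)⁻¹ − 1`), and the tree's μ-FREE lowest-term lemma
`X1.LambdaParity.sign_eq_neg_one_pow_lam` (strip `p^{μ}` — substitution is `ℤ_p`-linear and `Λ` is a domain —,
reduce modulo `p`, compare the coefficients of `T^λ` in the domain `𝔽_p⟦T⟧`, where the order of vanishing of
`L/p^μ mod p` IS `λ(L)`) gives `σ = (−1)^{λ(L^•)}` with no condition on `μ`. At the conductor level `σ = w(E)`.

## What is proved

* §1 **`rootNumber_eq_neg_one_pow_lam`** — `w(E) = (−1)^{λ(L_p^ε)}` for a Pollack pair, either sign, odd good `p`,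
  `a_p = 0`, newform of level `N_E`; NO `μ`, NO named fact. Corollaries: `even_lam_iff_rootNumber_eq_one`,
  **`even_lam_iff_even_analyticRank`** (`λ(L_p^ε) ≡ ord_{s=1} L(E,s) (mod 2)`), `even_lam_iff_even_order`
  (`λ(L_p^ε) ≡ ord_T L_p^ε`: the zeros of `L_p^ε` in the open unit disc OFF `T = 0` come in pairs),
  `even_lam_iff_of_signs` (`λ(L_p^+) ≡ λ(L_p^-)`); and in Kobayashi's `IsSignedPAdicLFunction` currency
  `neg_one_pow_lam_signed'` / `even_lam_signed_iff_even_analyticRank'` = the tree's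
  `Supersingular.neg_one_pow_lam_signed` / `even_lam_signed_iff_even_analyticRank` with BOTH `hL0` and `hμ` dropped.
* §2 (granted ONLY the `p`-parity theorem `hpar : p_parity W p`): `even_lam_iff_even_selmerCorank`
  (`λ(L_p^ε) ≡ corank_{ℤ_p} Sel_{p^∞}(E/ℚ) (mod 2)`) and **`selmerCorank_add_two_le_lam_of_lt`**: EXCESS ZEROS COME
  IN PAIRS — if `corank < λ(L_p^ε)` then `corank + 2 ≤ λ(L_p^ε)`. READING for the stub (w3 g0's
  `smallImageLambdaLowerAtThree_of_loci_of_excessZeroResidue`, residue «`corank < λ(L_3^ε)`»): the residue is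
  «`corank + 2 ≤ λ(L_3^ε)`», i.e. at least TWO zeros of `L_3^ε` in the open disc beyond the Selmer corank
  (the by-name statement is drawn in `…LambdaLowerThreeNsParity.lean`). The μ-free `ord_T L ≤ λ(L)` used on
  the way (`corank ≤ ord_T L_p^ε ≤ λ(L_p^ε)`) is already the tree's `X1.RankOneParitySqueeze.order_le_lam`.

References: [Sprung2017] Cor. 4.14 (`a_p = 0` display); [Pollack2003] Thm. 5.13, Prop. 6.18; [GreenbergLNM1716] §1
pp. 67–68, §5 p. 181; [GreenbergVatsal2000] (1)–(2); [DokchitserDokchitserAnnals2010] Thm. 1.4; [Kobayashi2003] (3.4)–(3.6).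
-/

set_option autoImplicit false
-- D-0017: single-problem summit, the namespace repeats the problem name by design.
set_option linter.dupNamespace false

noncomputable section

open scoped Classical MatrixGroups ModularForm

open CongruenceSubgroup PowerSeries WeierstrassCurve Literature.NumberTheory.EllipticCurves
  Literature.NumberTheory.EllipticCurves.ModularForms Literature.Barriers.BirchSwinnertonDyer
  Literature.NumberTheory.EllipticCurves.Rank1Residual Literature.NumberTheory.EllipticCurves.Sprung2017
  Literature.NumberTheory.EllipticCurves.Kobayashi2003
  Summit.BirchSwinnertonDyer.Rank1Residual.X1.MuLambda
  Summit.BirchSwinnertonDyer.Rank1Residual.Supersingular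

namespace Summit.BirchSwinnertonDyer.BirchSwinnertonDyer.Theorems.SmallImageLambdaParityMuFree

/-! ## §1. `w(E) = (−1)^{λ(L_p^ε)}` — NO `μ`, NO named fact -/

section RootNumber

variable (W : WeierstrassCurve ℚ) [W.IsElliptic] [W.IsGloballyMinimal] (p : ℕ) [Fact p.Prime]

/-- **The root number is the parity of `λ(L_p^ε)`, for either sign, with NO `μ`-hypothesis.** Let `p` be an odd
good prime of `E = W` with `a_p = 0`, `f ∈ S₂(Γ₀(N_E))` its newform, `(L⁺, L⁻)` a Pollack pair, `ε` a sign, and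
`L_p^ε = kobayashiL ε L⁺ L⁻` (Kobayashi's labelling). Then `w(E) = (−1)^{λ(L_p^ε)}`. Proof: Sprung's functional
equation `L_p^ε(T^ι) = w(E) (1+T)^{c+·} L_p^ε(T)` in `Λ` (tree THEOREM `cor414_sharpFlat_functionalEquation_apZero_holds`,
sign `σ = w(E)` at level `N_E` by `rootNumber_eq_neg_frickeEigenvalue`, exponents from
`exists_teichmuller_exponent_natCast` / `exists_sprung_exponents`), then the μ-free lowest-term lemma
`X1.LambdaParity.sign_eq_neg_one_pow_lam` (strip `p^μ`, reduce mod `p`, compare `T^λ`-coefficients in `𝔽_p⟦T⟧`).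
[cite: Sprung2017, Cor. 4.14 (a_p = 0 display)] [cite: GreenbergLNM1716, §1 (pp. 67–68) and §5 (p. 181)]
[cite: GreenbergVatsal2000, p. 2–3, (1)–(2)] -/
theorem rootNumber_eq_neg_one_pow_lam
    (hp : p ≠ 2) (hgood : W.HasGoodReductionAtPrime p) (hap : W.frobeniusTrace p = 0)
    [NeZero (W.conductorNorm ℤ)] {f : CuspForm (Gamma0 (W.conductorNorm ℤ)) 2} (hf : IsNewformOf W f)
    {Lplus Lminus : IwasawaAlgebra p} (hPP : IsPollackPair f p Lplus Lminus) (ε : ℤˣ) :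
    W.rootNumber = (-1) ^ lam (kobayashiL ε Lplus Lminus) := by
  -- the sign dictionary at level `N_W`
  have hw : (W.rootNumber : ℂ) = -frickeEigenvalue f :=
    rootNumber_eq_neg_frickeEigenvalue (fun _ _ ↦ IsNewform0.exists_functional_equation_holds)
      (fun _ _ ↦ IsNewform0.frickeEigenvalue_eq_one_or_eq_neg_one_holds) hf
  have hsm := IsNewform0.frickeInvolution_eq_smul_holds (N := W.conductorNorm ℤ) (k := (2 : ℤ)) hf.1
  have hFr : IsFrickeEigen (W.conductorNorm ℤ) f (frickeEigenvalue f) :=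
    isFrickeEigen_of_frickeInvolution_eq_smul _ hsm
  have hWσ : IsFrickeEigen (W.conductorNorm ℤ) f (-((W.rootNumber : ℤ) : ℂ)) := by
    rw [hw, neg_neg]; exact hFr
  have hσ : W.rootNumber ^ 2 = 1 := by
    rcases W.rootNumber_eq_one_or with h | h <;> rw [h] <;> norm_num
  -- Sprung's functional equation of the component of sign `ε` (tree theorem)
  have hpN : ¬ p ∣ W.conductorNorm ℤ := not_dvd_level_of_isNewformOf hf hgood
  obtain ⟨ηN, c, hc⟩ := exists_teichmuller_exponent_natCast p hpN
  obtain ⟨a, b, ha, hb⟩ := LargeImageParityStratum.exists_sprung_exponents (p := p)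
  have hSP : IsSprungPair f p 0 Lplus Lminus :=
    (isSprungPair_zero_iff f p Lplus Lminus).mpr ⟨hPP.2.2.1, hPP.2.2.2⟩
  set ι : IwasawaAlgebra p := invOnePlusSubOne with hιdef
  have hι : (1 + X : IwasawaAlgebra p) * (ι + 1) = 1 := one_add_X_mul_invOnePlusSubOne_add_one
  obtain ⟨hs, hfl⟩ := cor414_sharpFlat_functionalEquation_apZero_holds p W (W.conductorNorm ℤ) f hp hf hgood
    hap W.rootNumber hσ hWσ ηN c hc a b ha hb ι hι Lplus Lminus hSP
  set L := kobayashiL ε Lplus Lminus with hLdef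
  obtain ⟨e, he⟩ : ∃ e : ℤ_[p], L.subst ι =
      (W.rootNumber : IwasawaAlgebra p) * binomialSeries ℤ_[p] e * L := by
    rw [hLdef, kobayashiL]
    split_ifs
    · exact ⟨c + b, hfl⟩
    · exact ⟨c + a, hs⟩
  have hL0 : L ≠ 0 := by
    rw [hLdef, kobayashiL]
    split_ifs
    · exact hPP.2.1
    · exact hPP.1
  -- the μ-free lowest-term comparison
  have he' : L.subst ι = C ((W.rootNumber : ℤ) : ℤ_[p]) * binomialSeries ℤ_[p] e * L := by
    rw [he, map_intCast]
  have hσ' : ((W.rootNumber : ℤ) : ℤ_[p]) = 1 ∨ ((W.rootNumber : ℤ) : ℤ_[p]) = -1 := by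
    rcases W.rootNumber_eq_one_or with h | h <;> rw [h]
    · exact Or.inl (by push_cast; rfl)
    · exact Or.inr (by push_cast; rfl)
  have key := Summit.BirchSwinnertonDyer.Rank1Residual.X1.LambdaParity.sign_eq_neg_one_pow_lam hp hι hσ' (binomialSeries_constantCoeff (A := ℤ_[p]) e)
    hL0 he'
  have e1 : ((W.rootNumber : ℤ) : ℤ_[p]) = (((-1) ^ lam L : ℤ) : ℤ_[p]) := by rw [key]; push_cast; ring
  exact_mod_cast e1

/-- **`λ(L_p^ε)` is even iff `w(E) = +1`** (same hypotheses; no `μ`). [cite: Sprung2017, Cor. 4.14 (a_p = 0 display)]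
[cite: GreenbergLNM1716, §5 (p. 181)] -/
theorem even_lam_iff_rootNumber_eq_one
    (hp : p ≠ 2) (hgood : W.HasGoodReductionAtPrime p) (hap : W.frobeniusTrace p = 0)
    [NeZero (W.conductorNorm ℤ)] {f : CuspForm (Gamma0 (W.conductorNorm ℤ)) 2} (hf : IsNewformOf W f)
    {Lplus Lminus : IwasawaAlgebra p} (hPP : IsPollackPair f p Lplus Lminus) (ε : ℤˣ) :
    Even (lam (kobayashiL ε Lplus Lminus)) ↔ W.rootNumber = 1 := by
  have h := rootNumber_eq_neg_one_pow_lam W p hp hgood hap hf hPP ε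
  rw [h, neg_one_pow_eq_one_iff_even (by norm_num)]

/-- **`λ(L_p^ε) ≡ ord_{s=1} L(E, s) (mod 2)` for both signs, with NO `μ`-hypothesis and NO named fact** — the
μ-free form of the tree's `Supersingular.even_lam_signed_iff_even_analyticRank` (`hμ : mu L = 0`) and of the third
conjunct of `SignedMuVanishing.X7.mu_signed_eq_zero` (stated there under the conjecture-grade node). Odd good `p`,
`a_p = 0`, newform of level `N_E`, any Pollack pair. In analytic rank `0`, `λ(L_p^±)` is EVEN; in analytic rank `1`,
ODD (hence `≥ 1`). [cite: Sprung2017, Cor. 4.14 (a_p = 0 display)] [cite: GreenbergLNM1716, §5 (p. 181)] -/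
theorem even_lam_iff_even_analyticRank
    (hp : p ≠ 2) (hgood : W.HasGoodReductionAtPrime p) (hap : W.frobeniusTrace p = 0)
    [NeZero (W.conductorNorm ℤ)] {f : CuspForm (Gamma0 (W.conductorNorm ℤ)) 2} (hf : IsNewformOf W f)
    {Lplus Lminus : IwasawaAlgebra p} (hPP : IsPollackPair f p Lplus Lminus) (ε : ℤˣ) :
    Even (lam (kobayashiL ε Lplus Lminus)) ↔ Even W.analyticRank := by
  rw [even_lam_iff_rootNumber_eq_one W p hp hgood hap hf hPP ε,
    even_analyticRank_iff_of_isNewformOf_conductorLevel hf]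

/-- **`λ(L_p^ε) ≡ ord_T L_p^ε (mod 2)`**: the zeros of `L_p^ε` in the open unit disc OTHER than `T = 0` come in
pairs `a ↔ (1+a)⁻¹ − 1` (Greenberg's root pairing; both parities are `w(E)`: this file's §1 and the tree's
`LargeImageParityStratum.rootNumber_eq_neg_one_pow_order'`). No `μ`, no named fact.
[cite: GreenbergLNM1716, §5 (p. 181)] [cite: Sprung2017, Cor. 4.14 (a_p = 0 display)] -/
theorem even_lam_iff_even_order
    (hp : p ≠ 2) (hgood : W.HasGoodReductionAtPrime p) (hap : W.frobeniusTrace p = 0)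
    [NeZero (W.conductorNorm ℤ)] {f : CuspForm (Gamma0 (W.conductorNorm ℤ)) 2} (hf : IsNewformOf W f)
    {Lplus Lminus : IwasawaAlgebra p} (hPP : IsPollackPair f p Lplus Lminus) (ε : ℤˣ) :
    Even (lam (kobayashiL ε Lplus Lminus)) ↔ Even (kobayashiL ε Lplus Lminus).order.toNat := by
  have h1 := rootNumber_eq_neg_one_pow_lam W p hp hgood hap hf hPP ε
  have h2 := LargeImageParityStratum.rootNumber_eq_neg_one_pow_order' W p hp hgood hap hf hPP ε
  rw [h1] at h2
  rw [← neg_one_pow_eq_one_iff_even (R := ℤ) (by norm_num),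
    ← neg_one_pow_eq_one_iff_even (R := ℤ) (by norm_num), h2]

/-- **`λ(L_p^+) ≡ λ(L_p^-) (mod 2)`** (both are `≡ ord_{s=1} L(E,s)`); no `μ`, no named fact.
[cite: Sprung2017, Cor. 4.14 (a_p = 0 display)] [cite: GreenbergLNM1716, §5 (p. 181)] -/
theorem even_lam_iff_of_signs
    (hp : p ≠ 2) (hgood : W.HasGoodReductionAtPrime p) (hap : W.frobeniusTrace p = 0)
    [NeZero (W.conductorNorm ℤ)] {f : CuspForm (Gamma0 (W.conductorNorm ℤ)) 2} (hf : IsNewformOf W f)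
    {Lplus Lminus : IwasawaAlgebra p} (hPP : IsPollackPair f p Lplus Lminus) (ε ε' : ℤˣ) :
    Even (lam (kobayashiL ε Lplus Lminus)) ↔ Even (lam (kobayashiL ε' Lplus Lminus)) := by
  rw [even_lam_iff_even_analyticRank W p hp hgood hap hf hPP ε,
    even_lam_iff_even_analyticRank W p hp hgood hap hf hPP ε']

/-- **A lower bound read off parity: in ODD analytic rank `λ(L_p^ε) ≥ 1` for both signs** (no `μ`).
[cite: Sprung2017, Cor. 4.14 (a_p = 0 display)] [cite: GreenbergLNM1716, §5 (p. 181)] -/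
theorem one_le_lam_of_odd_analyticRank
    (hp : p ≠ 2) (hgood : W.HasGoodReductionAtPrime p) (hap : W.frobeniusTrace p = 0)
    [NeZero (W.conductorNorm ℤ)] {f : CuspForm (Gamma0 (W.conductorNorm ℤ)) 2} (hf : IsNewformOf W f)
    {Lplus Lminus : IwasawaAlgebra p} (hPP : IsPollackPair f p Lplus Lminus) (ε : ℤˣ)
    (hodd : Odd W.analyticRank) : 1 ≤ lam (kobayashiL ε Lplus Lminus) := by
  have h : Odd (lam (kobayashiL ε Lplus Lminus)) := by
    rw [← Nat.not_even_iff_odd, even_lam_iff_even_analyticRank W p hp hgood hap hf hPP ε, Nat.not_even_iff_odd]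
    exact hodd
  exact h.pos

end RootNumber

/-! ### Kobayashi's `IsSignedPAdicLFunction` currency: the tree's parity theorems with `hL0`, `hμ` DROPPED -/

section Signed

variable {W : WeierstrassCurve ℚ} [W.IsElliptic] [W.IsGloballyMinimal] {p : ℕ} [Fact p.Prime]

/-- **`(−1)^{λ(L_p^ε)} = w(E)` at `a_p = 0`, conductor level, for ANY `L` with `IsSignedPAdicLFunction f p ε L`**
— no `L ≠ 0`, no `μ(L) = 0` hypothesis (both held by the tree's `Supersingular.neg_one_pow_lam_signed`): such an
`L` IS the component of sign `ε` of Pollack's pair (`pollack_exists_plusMinusPAdicLFunction_holds`, uniqueness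
`IsSignedPAdicLFunction.unique`). [cite: Kobayashi2003, Thm. 3.2 and (3.4)–(3.6) (p. 7)]
[cite: Sprung2017, Cor. 4.14 (a_p = 0 display)] [cite: GreenbergLNM1716, §5 (p. 181)] -/
theorem neg_one_pow_lam_signed' [NeZero (W.conductorNorm ℤ)] {f : CuspForm (Gamma0 (W.conductorNorm ℤ)) 2}
    (hp : p ≠ 2) (hf : IsNewformOf W f) (hgood : W.HasGoodReductionAtPrime p) (hap : W.frobeniusTrace p = 0)
    {ε : ℤˣ} {L : IwasawaAlgebra p} (hL : IsSignedPAdicLFunction f p ε L) :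
    (-1 : ℤ) ^ lam L = W.rootNumber := by
  obtain ⟨Lplus, Lminus, hLp, hLm, hodd, heven⟩ :=
    pollack_exists_plusMinusPAdicLFunction_holds (W := W) (f := f) (p := p) hp hf hgood hap
  have hPP : IsPollackPair f p Lplus Lminus := ⟨hLp, hLm, hodd, heven⟩
  have hLeq : L = kobayashiL ε Lplus Lminus := hL.unique (hPP.isSignedPAdicLFunction_kobayashiL ε)
  rw [hLeq]
  exact (rootNumber_eq_neg_one_pow_lam W p hp hgood hap hf hPP ε).symm

/-- **`Even λ(L_p^ε) ↔ Even ord_{s=1} L(E, s)`** for ANY `L` with `IsSignedPAdicLFunction f p ε L` at the conductor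
level, `a_p = 0` — the tree's `Supersingular.even_lam_signed_iff_even_analyticRank` with `hL0` and `hμ` DROPPED.
[cite: Kobayashi2003, (3.4)–(3.6) (p. 7)] [cite: Sprung2017, Cor. 4.14 (a_p = 0 display)] [cite: GreenbergLNM1716, §5 (p. 181)] -/
theorem even_lam_signed_iff_even_analyticRank' [NeZero (W.conductorNorm ℤ)]
    {f : CuspForm (Gamma0 (W.conductorNorm ℤ)) 2} (hp : p ≠ 2) (hf : IsNewformOf W f)
    (hgood : W.HasGoodReductionAtPrime p) (hap : W.frobeniusTrace p = 0) {ε : ℤˣ} {L : IwasawaAlgebra p}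
    (hL : IsSignedPAdicLFunction f p ε L) : Even (lam L) ↔ Even W.analyticRank := by
  have hpar : Even W.analyticRank ↔ W.rootNumber = 1 := even_analyticRank_iff_of_isNewformOf_conductorLevel hf
  rw [hpar, ← neg_one_pow_lam_signed' hp hf hgood hap hL, neg_one_pow_eq_one_iff_even (by norm_num)]

end Signed

/-! ## §2. Granted the `p`-parity theorem: `λ(L_p^ε) ≡ corank Sel_{p^∞}(E/ℚ) (mod 2)` — EXCESS ZEROS COME IN PAIRS -/

section PParity

variable (W : WeierstrassCurve ℚ) [W.IsElliptic] [W.IsGloballyMinimal] (p : ℕ) [Fact p.Prime]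

/-- **`λ(L_p^ε)` and `corank_{ℤ_p} Sel_{p^∞}(E/ℚ)` have the same parity**, for either sign, granted ONLY the
`p`-parity theorem (`hpar : p_parity W p`, `(−1)^{corank} = w(E)`); no `μ`, Sprung's functional equation fed by its
tree proof. The μ-free λ-twin of `LargeImageParityStratum.even_order_iff_even_selmerCorank'`.
[cite: DokchitserDokchitserAnnals2010, Thm. 1.4] [cite: Sprung2017, Cor. 4.14 (a_p = 0 display)] [cite: GreenbergLNM1716, §5 (p. 181)] -/
theorem even_lam_iff_even_selmerCorank (hpar : p_parity W p)
    (hp : p ≠ 2) (hgood : W.HasGoodReductionAtPrime p) (hap : W.frobeniusTrace p = 0)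
    [NeZero (W.conductorNorm ℤ)] {f : CuspForm (Gamma0 (W.conductorNorm ℤ)) 2} (hf : IsNewformOf W f)
    {Lplus Lminus : IwasawaAlgebra p} (hPP : IsPollackPair f p Lplus Lminus) (ε : ℤˣ) :
    Even (lam (kobayashiL ε Lplus Lminus)) ↔ Even (W.selmerCorank p) := by
  have h1 := rootNumber_eq_neg_one_pow_lam W p hp hgood hap hf hPP ε
  have h2 : (-1 : ℤ) ^ W.selmerCorank p = W.rootNumber := hpar
  rw [h1] at h2
  rw [← neg_one_pow_eq_one_iff_even (R := ℤ) (by norm_num),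
    ← neg_one_pow_eq_one_iff_even (R := ℤ) (by norm_num), h2]

/-- **EXCESS ZEROS COME IN PAIRS.** Granted the `p`-parity theorem only: if `L_p^ε` has MORE zeros in the open unit
disc than the Selmer corank accounts for (`corank_{ℤ_p} Sel_{p^∞}(E/ℚ) < λ(L_p^ε)`), then it has at least TWO more:
`corank + 2 ≤ λ(L_p^ε)`. READING for `stub_lambdaLowerThree_ns` (w3 g0, `…LambdaLowerThreeNs` §3): the stub's open
residue off the two preprint loci — «the λ-inequality at the Pollack pairs with `corank < λ(L_3^ε)`» — is the same
statement at the pairs with `corank + 2 ≤ λ(L_3^ε)`. No `μ`. [cite: DokchitserDokchitserAnnals2010, Thm. 1.4]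
[cite: Sprung2017, Cor. 4.14 (a_p = 0 display)] [cite: GreenbergLNM1716, §5 (p. 181)] -/
theorem selmerCorank_add_two_le_lam_of_lt (hpar : p_parity W p)
    (hp : p ≠ 2) (hgood : W.HasGoodReductionAtPrime p) (hap : W.frobeniusTrace p = 0)
    [NeZero (W.conductorNorm ℤ)] {f : CuspForm (Gamma0 (W.conductorNorm ℤ)) 2} (hf : IsNewformOf W f)
    {Lplus Lminus : IwasawaAlgebra p} (hPP : IsPollackPair f p Lplus Lminus) (ε : ℤˣ)
    (hlt : W.selmerCorank p < lam (kobayashiL ε Lplus Lminus)) :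
    W.selmerCorank p + 2 ≤ lam (kobayashiL ε Lplus Lminus) := by
  have hparity := even_lam_iff_even_selmerCorank W p hpar hp hgood hap hf hPP ε
  set l := lam (kobayashiL ε Lplus Lminus) with hl
  set s := W.selmerCorank p with hs
  by_contra hlt2
  have h1 : l = s + 1 := by omega
  rw [h1, Nat.even_add_one] at hparity
  by_cases hs' : Even s
  · exact (hparity.mpr hs') hs'
  · exact hs' (hparity.mp hs')

/-- **The same in "difference" form: `λ(L_p^ε) − corank` is EVEN** (granted `p`-parity; with Kobayashi Thm. 1.2 / 4.1
the difference is the number of EXCESS zeros, `corank ≤ λ(L_p^ε)` by `SmallImageLambdaLowerThreeNs.selmerCorank_le_lam_kobayashiL`).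
[cite: DokchitserDokchitserAnnals2010, Thm. 1.4] [cite: Sprung2017, Cor. 4.14 (a_p = 0 display)] -/
theorem even_lam_sub_selmerCorank (hpar : p_parity W p)
    (hp : p ≠ 2) (hgood : W.HasGoodReductionAtPrime p) (hap : W.frobeniusTrace p = 0)
    [NeZero (W.conductorNorm ℤ)] {f : CuspForm (Gamma0 (W.conductorNorm ℤ)) 2} (hf : IsNewformOf W f)
    {Lplus Lminus : IwasawaAlgebra p} (hPP : IsPollackPair f p Lplus Lminus) (ε : ℤˣ)
    (hle : W.selmerCorank p ≤ lam (kobayashiL ε Lplus Lminus)) :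
    Even (lam (kobayashiL ε Lplus Lminus) - W.selmerCorank p) := by
  have hparity := even_lam_iff_even_selmerCorank W p hpar hp hgood hap hf hPP ε
  rcases Nat.even_or_odd (W.selmerCorank p) with hs | hs
  · exact (Nat.even_sub hle).mpr (iff_of_true (hparity.mpr hs) hs)
  · have hl : Odd (lam (kobayashiL ε Lplus Lminus)) := by
      rw [← Nat.not_even_iff_odd, hparity, Nat.not_even_iff_odd]; exact hs
    exact Nat.Odd.sub_odd hl hs

end PParity

end Summit.BirchSwinnertonDyer.BirchSwinnertonDyer.Theorems.SmallImageLambdaParityMuFree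

end
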